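import Literature.Computability.QuantumComplexity.StabilizerRank
import Literature.Computability.Complexity.Counting
import Literature.Computability.Complexity.CircuitClasses
import HarnessLib

/-!
# Mehraban–Tahmasbi 2024, Theorem 1.6: polynomial exact stabilizer rank of `|T⟩^{⊗m}` collapses `P^{#P}` into `P/poly`

Topic `Literature/Computability/QuantumComplexity`; ONE named fact (result in print,
`def … : Prop`, D-0014), companion of `ApproxStabilizerRankQuadratic.lean` (Thm 3.1, the
unconditional `Ω̃(m²)` lower bound) and `ApproxStabilizerRankTransfer.lean` (Lemma 3.6 etc.),
deliberately not duplicated here. It is the only CONDITIONAL superpolynomial lower bound in print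
for the EXACT stabilizer rank of magic-state powers, and grounds the cruxes
`Summit.QuantumAdvantage.QuantumAdvantage.Theses.AmplitudeProofs.ApcMagicRankExponential` /
`ApcPrefixRankSuperpoly` (route `QuantumAdvantage/AmplitudeProofs`): through the route's glue
`ApcOfMagicRank`, `ApcPrefixRankSuperpoly` holds unless `P^{#P} ⊆ P/poly`.

S. Mehraban, M. Tahmasbi, *Quadratic lower bounds on the approximate stabilizer rank: a
probabilistic approach*, STOC 2024 = arXiv:2305.10277, §1.3, p. 5 (held text read):

> **Theorem 1.6.** The exact rank of the magic state `|T⟩^{⊗m}` is super-polynomial unless the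
> permanent has polynomial circuits.
>
> *Proof.* We show that if `χ(T^{⊗m}) = poly(m)`, there exists a polynomial-time algorithm with
> polynomial advice (and therefore a polynomial-size circuit) for the problem of computing the gap
> of a polynomial-size classical circuit. A polynomial-size circuit for this problem implies a
> polynomial-size circuit for the permanent. […] `⟨0ⁿ1| H^{⊗n+1} U_f H^{⊗n} ⊗ I |0^{n+1}⟩ = gap(f)/(√2·2ⁿ)`.

## Rendering

Hypothesis: `χ(|T⟩^{⊗m}) ≤ m^c + c` for some `c` and all `m` (the tree's `stabilizerRank`,
`tensorPow magicT`, `StabilizerRank.lean`). Conclusion: the proof's own intermediate statement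
"the gap of a polynomial-size classical circuit is computable by polynomial-size circuits", i.e.
`GapP ⊆ FP/poly`, recorded in the tree's language classes as `P^{#P} ⊆ P/poly`
(`Literature.Computability.Complexity.PSharpP ⊆ PPoly`). This is EQUIVALENT to the printed
"the permanent has polynomial[-size Boolean] circuits": `⇐` by Valiant's `#P`-hardness of the
`0/1` permanent (`P^{#P} ⊆ P^{per} ⊆ P/poly`, cf. `AlgebraicComplexity/PermanentBitsPPoly.lean`),
`⇒` because the bit graph of the permanent lies in `P^{#P}`. Nothing here is asserted; users take
`(h : MehrabanTahmasbi2024_PSharpP_subset_PPoly_of_stabilizerRank_poly)`.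

What is NOT here: Cor. 1.9 (the same for `2^{-Ω(n)}`-approximate rank), Thm 1.10/1.11
(Bravyi–Gosset: polynomial APPROXIMATE rank ⇒ `BPP/poly` sampling of `BQP` circuits; collapse of
`PH` under average-case conjectures), Thm 1.2/Conj. 1.3 (rank versus circuit complexity).
-/

noncomputable section

namespace Literature.Computability.QuantumComplexity

open Literature.Computability.Complexity

/-- **Mehraban–Tahmasbi 2024, Theorem 1.6** (arXiv:2305.10277, §1.3, p. 5): "The exact rank of the
magic state `|T⟩^{⊗m}` is super-polynomial unless the permanent has polynomial circuits" — proof: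
a polynomial exact stabilizer decomposition of `|T⟩^{⊗m}`, given as advice, computes
`gap(f) = √2·2ⁿ·⟨0ⁿ1|H^{⊗n+1}U_f H^{⊗n}⊗I|0^{n+1}⟩` of any polynomial-size classical circuit `f` in
polynomial time, so `GapP ⊆ FP/poly` and `P^{#P} ⊆ P/poly`. Rendered contrapositively with that
conclusion: if `χ(|T⟩^{⊗m}) ≤ m^c + c` for all `m`, then `P^{#P} ⊆ P/poly` (equivalent to
polynomial-size circuits for the permanent by Valiant 1979). Grounds
`…Theses.AmplitudeProofs.ApcMagicRankExponential` / `ApcPrefixRankSuperpoly` conditionally.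
[cite: MehrabanTahmasbi2024, Theorem 1.6 (arXiv p. 5)] -/
def MehrabanTahmasbi2024_PSharpP_subset_PPoly_of_stabilizerRank_poly : Prop :=
  (∃ c : ℕ, ∀ m : ℕ, stabilizerRank (tensorPow magicT m) ≤ m ^ c + c) → PSharpP ⊆ PPoly

end Literature.Computability.QuantumComplexity

end
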